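import Literature.Computability.Complexity.StackPrograms
import HarnessLib

/-!
# Stack register machines are TM2 machines: step-for-step compilation

Trunk `CplxCore`, toolkit for `TimeBounds.lean`, continuing `StackMachines.lean` and
`StackPrograms.lean`. There, a stack register program (`SProg K`: `K` binary stack registers,
instructions `push`/`pop`/`goto`) is run on Mathlib's multi-stack machines `Turing.FinTM2` by a
*clocked transducer simulation* (`SProg.outputFn_mem_FP`): each program step is one pass of a
finite-state transducer over the encoded configuration, and the number of passes is a
*polynomial* clock written on the tape. That packaging is confined to polynomial time.

This file gives the direct simulation, with no clock and no overhead: a stack register program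
*is* a TM2 machine — its registers are the stacks (alphabet `Bool`), its addresses are the
labels, and every instruction is one TM2 statement — so that `t` program steps are exactly
`t` machine steps (plus one final `halt` step). Consequently any cost bound established in the
cost semantics of `StackPrograms.lean` (`Com.Exec`, `Com.Runs`), polynomial or not, is a running
time on `FinTM2`:

* `SProg.toTM2 P inp out` — the machine: stacks `Fin K` over `Bool`, input stack `inp`, output
  stack `out`, labels `Fin (|P| + 1)` (label `i < |P|` executes instruction `i`; the label `|P|`,
  reached by every jump beyond the program, executes `halt`), states `Option Bool` (the popped
  bit, consumed by the same statement and reset);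
* `SProg.step_tcfg` — one program step at an address `< |P|` is one machine step on embedded
  configurations (`SProg.tcfg`); `SProg.reachesIn_of_iterate` — a run of `t` program steps ending
  at a halted address is matched by a machine run of at most `t + 1` steps ending in the TM2
  halting configuration;
* `SProg.outputsWithin_of_iterate` — **main result, machine form**: if `t` steps from address `0`
  with the input word `z` in register `inp` (all other registers empty) reach a halted address
  with the word `o` in register `out` (all other registers empty), then the bundled machine
  `SProg.toAux P inp out : TM2ComputableAux Bool Bool` outputs `o` on `z` within `t + 1` steps
  (`TM2ComputableAux.OutputsWithin`, i.e. Mathlib's `TM2OutputsInTime`);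
* `Com.outputsWithin_of_exec`, `Com.outputsWithin_of_exec_equiv` — **program form**: an
  execution `Com.Exec c (init z) s R' t` of a structured program whose final register file is
  "output `o` in `out`, all else empty" yields `OutputsWithin z o (t + 1)` for the compiled
  machine (for registers indexed by `Fin K`, resp. by any finite type through an equivalence).

This is the device by which exponential running times (e.g. exhaustive search for `k`-SAT,
`Literature.Computability.FineGrained.kSATInExpTime_one`) are established in the tree's `FinTM2`-based statements
without building Turing machines by hand. Nothing here is in Mathlib (whose only timed TM2
machine is the identity, `Turing.idComputableInPolyTime`).

## References

* M. L. Minsky, *Computation: Finite and Infinite Machines*, Prentice-Hall 1967, §11.1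
  (program machines), §14.1 (push-down registers over `{0,1}`): the machine model.
* T. Nipkow, G. Klein, *Concrete Semantics with Isabelle/HOL*, Springer 2014, §8.3 (compiler
  correctness with step counts; used through `Com.Exec.compile_iterate`).
* S. Arora, B. Barak, *Computational Complexity: A Modern Approach*, CUP 2009, §1.2–1.3
  (multi-tape machines; running time as the number of steps).
* Mathlib, `Mathlib/Computability/TuringMachine/Computable.lean` (`FinTM2`, `initList`,
  `haltList`, `TM2OutputsInTime`).
-/

namespace Literature.Computability.Complexity

open Turing StateTransition Function TM2Iter TM2Comp

namespace SProg

variable {K : ℕ} (P : SProg K)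

/-! ### The machine of a stack register program -/

/-- The TM2 statements of the compiled machine act on `K` Boolean stacks, jump to labels
`Fin (|P| + 1)` and use one register `Option Bool`. [folklore] -/
abbrev TStmt (K n : ℕ) : Type := TM2.Stmt (fun _ : Fin K => Bool) (Fin (n + 1)) (Option Bool)

/-- The configurations of the compiled machine. [folklore] -/
abbrev TCfg (K n : ℕ) : Type := TM2.Cfg (fun _ : Fin K => Bool) (Fin (n + 1)) (Option Bool)

/-- "Jump to address `j`": reset the register and go to the label `min j |P|` (every address
beyond the program is the halting label `|P|`). [Minsky 1967, §11.1] [folklore] -/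
def jmpStmt (j : ℕ) : TStmt K P.length :=
  .load (fun _ => none) (.goto fun _ => clampPc P.length j)

/-- The TM2 statement of the instruction `ins` at address `i`: `push k b` pushes and falls
through to `i + 1`; `goto j` jumps; `pop k jt jf jn` pops stack `k` into the register and
branches on it. [Minsky 1967, §11.1, §14.1] [folklore] -/
def instrStmt (i : ℕ) : SInstr K → TStmt K P.length
  | .push k b => .push k (fun _ => b) (P.jmpStmt (i + 1))
  | .goto j => P.jmpStmt j
  | .pop k jt jf jn => .pop k (fun _ o => o)
      (.branch (fun v => decide (v = some true)) (P.jmpStmt jt)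
        (.branch (fun v => decide (v = some false)) (P.jmpStmt jf) (P.jmpStmt jn)))

/-- The program of the compiled machine: label `l` executes instruction `l` of `P`, the label
`|P|` halts. [folklore] -/
def tmStmt (l : Fin (P.length + 1)) : TStmt K P.length :=
  match P[l.val]? with
  | none => .halt
  | some ins => P.instrStmt l.val ins

variable (inp out : Fin K)

/-- **The stack register program `P` as a multi-stack machine** (`Turing.FinTM2`): stacks
`Fin K` over `Bool` (input stack `inp`, output stack `out`), labels `Fin (|P| + 1)` with main
label `0`, states `Option Bool` (initially `none`), program `tmStmt`.
[Minsky 1967, §11.1, §14.1; Arora–Barak 2009, §1.2] [folklore] -/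
def toTM2 : FinTM2 where
  K := Fin K
  k₀ := inp
  k₁ := out
  Γ := fun _ => Bool
  Λ := Fin (P.length + 1)
  main := 0
  σ := Option Bool
  initialState := none
  m := P.tmStmt

/-- The compiled machine bundled with the identity alphabet identifications, as a
`TM2ComputableAux Bool Bool`. [folklore] -/
def toAux : TM2ComputableAux Bool Bool :=
  ⟨P.toTM2 inp out, Equiv.refl _, Equiv.refl _⟩

/-- The embedding of program configurations: address `pc` becomes the label `min pc |P|`, the
register is `none`, the registers are the stacks. [folklore] -/
def tcfg (c : SCfg K) : TCfg K P.length :=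
  ⟨some (clampPc P.length c.pc), none, c.regs⟩

/-- The halting configuration of the compiled machine with stacks `R`. [folklore] -/
def thalt (R : Regs (Fin K)) : TCfg K P.length :=
  ⟨none, none, R⟩

/-! ### One step -/

/-- A step of the compiled machine at a label, unbundled. [folklore] -/
theorem step_some (l : Fin (P.length + 1)) (v : Option Bool) (S : ∀ _ : Fin K, List Bool) :
    (P.toTM2 inp out).step (⟨some l, v, S⟩ : TCfg K P.length) =
      some (TM2.stepAux (P.tmStmt l) v S) :=
  rfl

/-- The jump statement lands on the clamped label with the register reset. [folklore] -/
@[simp] theorem stepAux_jmpStmt (j : ℕ) (v : Option Bool) (S : ∀ _ : Fin K, List Bool) :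
    TM2.stepAux (P.jmpStmt j) v S = (⟨some (clampPc P.length j), none, S⟩ : TCfg K P.length) :=
  rfl

/-- At a halted address (`|P| ≤ pc`) the compiled machine executes `halt`: one step to the
halting configuration. [folklore] -/
theorem step_tcfg_of_le {c : SCfg K} (hc : P.length ≤ c.pc) :
    (P.toTM2 inp out).step (P.tcfg c) = some (P.thalt c.regs) := by
  rw [tcfg, step_some, tmStmt]
  have hl : (clampPc P.length c.pc).val = P.length := by simp [hc]
  rw [hl, List.getElem?_eq_none_iff.2 le_rfl]
  rfl

/-- **One program step is one machine step**: at an address `< |P|`, the compiled machine maps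
the embedded configuration to the embedding of the next configuration.
[Minsky 1967, §11.1, §14.1] [folklore] -/
theorem step_tcfg {c : SCfg K} (hc : c.pc < P.length) :
    (P.toTM2 inp out).step (P.tcfg c) = some (P.tcfg (P.step c)) := by
  obtain ⟨pc, R⟩ := c
  change pc < P.length at hc
  obtain ⟨ins, hins⟩ : ∃ ins, P[pc]? = some ins := ⟨P[pc], List.getElem?_eq_getElem hc⟩
  rw [tcfg, step_some, tmStmt, Com.step_of_getElem? hins]
  have hl : (clampPc P.length pc).val = pc := by simp [hc.le]
  simp only [hl, hins]
  cases ins with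
  | push k b => rfl
  | goto j => rfl
  | pop k jt jf jn =>
    simp only [instrStmt, TM2.stepAux]
    rcases hR : R k with _ | ⟨_ | _, w⟩
    · have hupd : update R k [] = R := by rw [← hR]; exact update_eq_self k R
      simp [hupd, tcfg]
    · simp [tcfg]
    · simp [tcfg]

/-! ### Runs -/

/-- **A halting run of the program is a halting run of the machine.** If `t` program steps lead
from `c` to a configuration `c'` at a halted address, then the compiled machine reaches the
halting configuration with the registers of `c'` from the embedding of `c` within `t + 1`
steps (idle program steps at the halted address are not executed by the machine, whence "within").
[Nipkow–Klein 2014, §8.3; Minsky 1967, §11.1] [folklore] -/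
theorem reachesIn_of_iterate (t : ℕ) :
    ∀ {c c' : SCfg K}, P.step^[t] c = c' → P.length ≤ c'.pc →
      ReachesIn (P.toTM2 inp out).step (P.tcfg c) (P.thalt c'.regs) (t + 1) := by
  induction t with
  | zero =>
    intro c c' h hc'
    subst h
    exact ReachesIn.single (P.step_tcfg_of_le inp out hc')
  | succ t ih =>
    intro c c' h hc'
    rw [iterate_succ_apply] at h
    by_cases hc : P.length ≤ c.pc
    · -- the program idles at `c`; the machine halts at once
      rw [P.step_of_le hc] at h
      exact (ih h hc').mono (Nat.le_succ _)
    · exact ReachesIn.step_trans (P.step_tcfg inp out (not_le.1 hc)) (ih h hc')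

/-- The initial configuration of the compiled machine on the input word `z` is the embedding of
the program configuration "address `0`, `z` in register `inp`, all other registers empty". [folklore] -/
theorem initList_toTM2 (z : List Bool) :
    initList (P.toTM2 inp out) z = P.tcfg ⟨0, update (fun _ => []) inp z⟩ := by
  rw [initList_eq]
  change (⟨some 0, none, update (fun _ => ([] : List Bool)) inp z⟩ : TCfg K P.length) = _
  simp only [tcfg]
  congr

/-- The halting configuration of the compiled machine with output word `o`. [folklore] -/
theorem haltList_toTM2 (o : List Bool) :
    haltList (P.toTM2 inp out) o = P.thalt (update (fun _ => []) out o) := by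
  rw [haltList_eq]
  rfl

/-- **Main result (machine form).** If `t` steps of the stack register program `P`, started at
address `0` with the word `z` in register `inp` and all other registers empty, reach a halted
address (`≥ |P|`) with the word `o` in register `out` and all other registers empty, then the
compiled machine outputs `o` on input `z` within `t + 1` steps.
[Minsky 1967, §11.1, §14.1; Arora–Barak 2009, §1.2] [folklore] -/
theorem outputsWithin_of_iterate {z o : List Bool} {t pc : ℕ}
    (h : P.step^[t] ⟨0, update (fun _ => []) inp z⟩ = ⟨pc, update (fun _ => []) out o⟩)
    (hpc : P.length ≤ pc) :
    (P.toAux inp out).OutputsWithin z o (t + 1) := by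
  apply outputsWithin_of_reachesIn
  change ReachesIn (P.toTM2 inp out).step (initList (P.toTM2 inp out) (z.map id))
    (haltList (P.toTM2 inp out) (o.map id)) (t + 1)
  rw [List.map_id, List.map_id, initList_toTM2, haltList_toTM2]
  exact P.reachesIn_of_iterate inp out t h hpc

end SProg

/-! ### Structured programs -/

namespace Com

variable {K : ℕ}

/-- **Main result (program form).** An execution of the structured program `c` (stopped by
`halt` or not) of cost `t`, from "input `z` in register `inp`, all else empty" to "output `o`
in register `out`, all else empty", is realised by the compiled machine within `t + 1` steps.
[Nipkow–Klein 2014, §8.3; Arora–Barak 2009, §1.2] [folklore] -/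
theorem outputsWithin_of_exec {c : Com (Fin K)} {inp out : Fin K} {z o : List Bool} {s : Bool}
    {t : ℕ} (h : Exec c (update (fun _ => []) inp z) s (update (fun _ => []) out o) t) :
    ((compile c).toAux inp out).OutputsWithin z o (t + 1) :=
  (compile c).outputsWithin_of_iterate inp out (h.compile_iterate le_rfl) (by simp)

/-- `Regs.init inp z` is the single-register update of the empty register file. [folklore] -/
theorem init_eq_update {ι : Type} [DecidableEq ι] (inp : ι) (z : List Bool) :
    Regs.init inp z = update (fun _ => []) inp z := by
  funext i
  by_cases h : i = inp
  · subst h; simp [Regs.init]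
  · simp [Regs.init, h]

/-- **Program form, for registers indexed by any finite type.** If the structured program `c`
over registers `ι` executes with cost `t` from `Regs.init inp z` to `Regs.init out o` (output
`o` in register `out`, all else empty), then, after renaming the registers along any
`e : ι ≃ Fin K`, the compiled machine outputs `o` on `z` within `t + 1` steps.
[Nipkow–Klein 2014, §8.3; Arora–Barak 2009, §1.2] [folklore] -/
theorem outputsWithin_of_exec_equiv {ι : Type} [DecidableEq ι] (e : ι ≃ Fin K) {c : Com ι}
    {inp out : ι} {z o : List Bool} {s : Bool} {t : ℕ}
    (h : Exec c (Regs.init inp z) s (Regs.init out o) t) :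
    ((compile (c.map e)).toAux (e inp) (e out)).OutputsWithin z o (t + 1) := by
  have h' := h.map_equiv e
  have hi : Regs.init inp z ∘ e.symm = update (fun _ => []) (e inp) z := by
    rw [init_eq_update]; funext k
    simp only [comp_apply]
    by_cases hk : k = e inp
    · subst hk; simp
    · rw [update_of_ne hk, update_of_ne]
      intro h''; exact hk (by rw [← h'']; simp)
  have ho : Regs.init out o ∘ e.symm = update (fun _ => []) (e out) o := by
    rw [init_eq_update]; funext k
    simp only [comp_apply]
    by_cases hk : k = e out
    · subst hk; simp
    · rw [update_of_ne hk, update_of_ne]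
      intro h''; exact hk (by rw [← h'']; simp)
  rw [hi, ho] at h'
  exact outputsWithin_of_exec h'

/-- **Budgeted form.** If the program runs (or stops) within budget `B` from `Regs.init inp z`
to `Regs.init out o`, the compiled machine outputs `o` on `z` within `B + 1` steps. [folklore] -/
theorem outputsWithin_of_runs_equiv {ι : Type} [DecidableEq ι] (e : ι ≃ Fin K) {c : Com ι}
    {inp out : ι} {z o : List Bool} {B : ℕ}
    (h : Runs c (Regs.init inp z) (Regs.init out o) B ∨
      Halts c (Regs.init inp z) (Regs.init out o) B) :
    ((compile (c.map e)).toAux (e inp) (e out)).OutputsWithin z o (B + 1) := by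
  rcases h with ⟨t, ht, hx⟩ | ⟨t, ht, hx⟩
  · exact (outputsWithin_of_exec_equiv e hx).mono (by omega)
  · exact (outputsWithin_of_exec_equiv e hx).mono (by omega)

end Com

end Literature.Computability.Complexity
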